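import Summits.Ventures.PercRepro.ProfilePointedCircuitClassesGeneric

/-!
# PercRepro — THE CLASS `#C = ν − 2` AT EVERY NULLITY, I: THE RANK TOOLS (p5, gen 37; `proofs/P5-GM1.md` §53(e), generic)

The non-coloop removal lemmas (`exists_subset_card_rk_sdiff_eq`: while at least four points of a set `T` with
`ρ(X) ≤ ρ(X ∖ T) + 3` remain, one of them is not a coloop; `exists_subset_card_rk_le_sdiff_add_one`: a `(ν − 2)`-subset
of `T` whose removal costs at most one rank) and the «at least two valid points» lemma `two_le_card_filter_valid_gen`
for `T := (E − x) ∖ V` of `ν` points — the tools of the two-free-point class at every nullity `ν ≥ 3`.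
-/

open scoped Matroid

namespace PercRepro.Cogirth

open Finset ThmH Skew Shadow Profile

variable {α : Type} [DecidableEq α] {N : Matroid α} [N.Finite]

section GenericTwoTools

/-- **NON-COLOOP REMOVALS**: if `T ⊆ X` and `ρ(X) ≤ ρ(X ∖ T) + 3`, then for every `m` with `m + 3 ≤ #T` some `m`-subset
`S ⊆ T` can be removed from `X` without lowering its rank (greedily: while at least four points of `T` remain, not
all of them are coloops of the current set). -/
theorem exists_subset_card_rk_sdiff_eq {X T : Finset α} (hT : T ⊆ X) (hrk : rk N X ≤ rk N (X \ T) + 3) :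
    ∀ m : ℕ, m + 3 ≤ T.card → ∃ S ⊆ T, S.card = m ∧ rk N (X \ S) = rk N X := by
  intro m
  induction m with
  | zero => intro _; exact ⟨∅, empty_subset _, card_empty, by rw [sdiff_empty]⟩
  | succ m ih =>
    intro hm
    obtain ⟨S, hST, hScard, hSrk⟩ := ih (by omega)
    -- the remaining points `T ∖ S` (at least four) are not all coloops of `X ∖ S`
    have hTS : T \ S ⊆ X \ S := sdiff_subset_sdiff hT (Subset.refl _)
    have hcard : 4 ≤ (T \ S).card := by rw [card_sdiff_of_subset hST]; omega
    have hXS : (X \ S) \ (T \ S) = X \ T := by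
      ext a
      simp only [mem_sdiff, not_and, not_not]
      constructor
      · rintro ⟨⟨haX, haS⟩, h⟩
        exact ⟨haX, fun haT => haS (h haT)⟩
      · rintro ⟨haX, haT⟩
        exact ⟨⟨haX, fun haS => haT (hST haS)⟩, fun haT' => absurd haT' haT⟩
    by_contra hno
    have hall : ∀ t ∈ T \ S, rk N ((X \ S).erase t) < rk N (X \ S) := by
      intro t ht
      have h1 : rk N ((X \ S).erase t) ≤ rk N (X \ S) := rk_le_rk_of_subset_finset (erase_subset _ _)
      refine lt_of_le_of_ne h1 (fun heq => ?_)
      have htT : t ∈ T := (mem_sdiff.1 ht).1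
      have htS : t ∉ S := (mem_sdiff.1 ht).2
      have e : X \ insert t S = (X \ S).erase t := by
        ext a
        simp only [mem_sdiff, mem_insert, mem_erase, not_or]
        tauto
      exact hno ⟨insert t S, insert_subset htT hST, by rw [card_insert_of_notMem htS, hScard],
        by rw [e, heq, hSrk]⟩
    have := rk_sdiff_add_card_le_of_forall_coloop (T \ S) hTS hall
    rw [hXS, hSrk] at this
    omega

/-- **ONE MORE REMOVAL**: for `1 ≤ m`, `m + 2 ≤ #T` (and `X ⊆ E`), some `m`-subset `S ⊆ T` has `ρ(X) ≤ ρ(X ∖ S) + 1`. -/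
theorem exists_subset_card_rk_le_sdiff_add_one {X T : Finset α} (hX : X ⊆ gr N) (hT : T ⊆ X)
    (hrk : rk N X ≤ rk N (X \ T) + 3) {m : ℕ} (hm1 : 1 ≤ m) (hm : m + 2 ≤ T.card) :
    ∃ S ⊆ T, S.card = m ∧ rk N X ≤ rk N (X \ S) + 1 := by
  obtain ⟨S₀, hS₀T, hS₀card, hS₀rk⟩ := exists_subset_card_rk_sdiff_eq hT hrk (m - 1) (by omega)
  obtain ⟨t, htT, htS₀⟩ := exists_mem_notMem_of_card_lt_card (show S₀.card < T.card by omega)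
  refine ⟨insert t S₀, insert_subset htT hS₀T, by rw [card_insert_of_notMem htS₀, hS₀card]; omega, ?_⟩
  have e : X \ insert t S₀ = (X \ S₀).erase t := by
    ext a
    simp only [mem_sdiff, mem_insert, mem_erase, not_or]
    tauto
  have htX : t ∈ X \ S₀ := mem_sdiff.2 ⟨hT htT, htS₀⟩
  have e2 : insert t ((X \ S₀).erase t) = X \ S₀ := insert_erase htX
  have htg : t ∈ gr N := hX (hT htT)
  have hsub : (X \ S₀).erase t ⊆ gr N := ((erase_subset _ _).trans sdiff_subset).trans hX
  have h := rk_insert_eq (M := N) htg hsub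
  rw [e2] at h
  rw [e, ← hS₀rk, h]
  split_ifs <;> omega


/-- **AT MOST TWO INVALID POINTS** (generic in `ν`; the type (iii) of the class `#C = ν − 2`): for a unit `V` of a class `C` with `x ∈ cl C`, a point
`q' ∈ V ∖ C` with `E − q'` spanning, and `T := (E − x) ∖ V` (`ν` points), at least two points `t ∈ T` satisfy
`t ∉ cl(V − q')` — otherwise `E − q' − t₅` lies in `cl(V − q')`, of rank `#V − 1`, while its rank is `≥ ρ(E) − 1`. -/
theorem two_le_card_filter_valid_gen {x q' : α} {C V : Finset α} (hVg : V ⊆ gr N) (hVrk : rk N V = V.card)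
    (_hxV : x ∉ V) (hCV : C ⊆ V) (hxC : x ∈ clF N C) (hq'V : q' ∈ V) (hq'C : q' ∉ C)
    (hq : rk N ((gr N).erase q') = rk N (gr N)) {ν : ℕ} (hTν : ((gr N).erase x \ V).card = ν)
    (hVcard : V.card + (ν + 1) = (gr N).card) (hν : 3 ≤ ν) (hn : (gr N).card = rk N (gr N) + ν) (hR : ν + 2 ≤ rk N (gr N)) :
    2 ≤ (((gr N).erase x \ V).filter (fun t => t ∉ clF N (V.erase q'))).card := by
  by_contra hlt
  have hlt : (((gr N).erase x \ V).filter (fun t => t ∉ clF N (V.erase q'))).card < 2 := Nat.lt_of_not_le hlt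
  set T := (gr N).erase x \ V with hT
  set Tv := T.filter (fun t => t ∉ clF N (V.erase q')) with hTv
  -- a point `t₅ ∈ T` with `Tv ⊆ {t₅}`
  have hex : ∃ t₅ ∈ T, Tv ⊆ {t₅} := by
    rcases Tv.eq_empty_or_nonempty with hemp | ⟨t, ht⟩
    · obtain ⟨t, ht⟩ : T.Nonempty := card_pos.1 (by omega)
      exact ⟨t, ht, by rw [hemp]; exact empty_subset _⟩
    · refine ⟨t, (mem_filter.1 ht).1, ?_⟩
      intro t' ht'
      rw [mem_singleton]
      have h2 : Tv.card ≤ 1 := by omega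
      exact card_le_one.1 h2 t' ht' t ht
  obtain ⟨t₅, ht₅T, hTv₄⟩ := hex
  have ht₅g : t₅ ∈ gr N := (mem_erase.1 (mem_sdiff.1 ht₅T).1).2
  have ht₅V : t₅ ∉ V := (mem_sdiff.1 ht₅T).2
  have ht₅q : t₅ ≠ q' := fun h => ht₅V (h ▸ hq'V)
  have hxg : x ∈ gr N := clF_subset_gr C hxC
  -- `E − q' − t₅ ⊆ cl(V − q')`
  have hVe : V.erase q' ⊆ gr N := (erase_subset _ _).trans hVg
  have hCVe : C ⊆ V.erase q' := by
    intro c hc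
    rw [mem_erase]
    exact ⟨fun h => hq'C (h ▸ hc), hCV hc⟩
  have hsub : ((gr N).erase q').erase t₅ ⊆ clF N (V.erase q') := by
    intro a ha
    rw [mem_erase, mem_erase] at ha
    obtain ⟨hat, haq, hag⟩ := ha
    by_cases haV : a ∈ V
    · exact subset_clF_self_of_subset_gr hVe (mem_erase.2 ⟨haq, haV⟩)
    · by_cases hax : a = x
      · rw [hax]
        exact mem_clF_of_subset hCVe hxC
      · have haT : a ∈ T := mem_sdiff.2 ⟨mem_erase.2 ⟨hax, hag⟩, haV⟩
        by_contra hacl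
        have : a ∈ Tv := mem_filter.2 ⟨haT, hacl⟩
        exact hat (mem_singleton.1 (hTv₄ this))
  have h1 : rk N (((gr N).erase q').erase t₅) ≤ rk N (V.erase q') := by
    have := rk_le_rk_of_subset_finset (M := N) hsub
    rwa [rk_clF_eq_rk] at this
  have h2 : rk N (V.erase q') = V.card - 1 := by
    rw [rk_eq_card_of_subset_of_rk_eq_card (erase_subset _ _) hVrk, card_erase_of_mem hq'V]
  have h3 : rk N ((gr N).erase q') ≤ rk N (((gr N).erase q').erase t₅) + 1 := by
    have e : insert t₅ (((gr N).erase q').erase t₅) = (gr N).erase q' :=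
      insert_erase (mem_erase.2 ⟨ht₅q, ht₅g⟩)
    have := rk_insert_eq (M := N) ht₅g ((erase_subset _ _).trans (erase_subset _ _)) (e := t₅)
      (X := ((gr N).erase q').erase t₅)
    rw [e] at this
    rw [this]
    split_ifs <;> omega
  have h4 : rk N (gr N) ≤ rk N (((gr N).erase q').erase t₅) + 1 := hq ▸ h3
  have h5 : rk N (((gr N).erase q').erase t₅) ≤ V.card - 1 := h1.trans (le_of_eq h2)
  have h6 : 5 ≤ V.card := by
    have := hn
    have := hVcard
    have := hR
    omega
  omega


end GenericTwoTools

end PercRepro.Cogirth
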